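import Mathlib.Data.Finset.Update
import Mathlib.Algebra.Order.BigOperators.Group.Finset
import Mathlib.Data.Real.Basic
import Mathlib.Data.Fintype.BigOperators
import Mathlib.Tactic.Ring
import Mathlib.Tactic.Linarith
import Mathlib.Tactic.Positivity
import Mathlib.Tactic.Push

/-!
# Telescoping over the coordinates of a finite product

Helper for stub `stub_spreadFromParts` (S6) of line `free-volume-heavy-witness`
(crux `Summit.QuantumFields.QCD.Theses.SpectralDefectExtinction.WindowExtinction`,
item stmt-QuantumFields-8964).  Pure algebra, no project vocabulary.

* `spread_telescope_abs_le` — a real function on `I → T` all of whose mixed second differences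
  (in two distinct coordinates, at every base point) are `≤ γ` is additive up to
  `(card I)² γ`: `|φ s - φ s₀ - ∑ i, (φ (s₀[i ↦ s i]) - φ s₀)| ≤ (card I)² γ`.
  (This is how the quasi-local `|det|`-tilt is peeled off the product structure.)
* `spread_exact_updateFinset` — if single-coordinate updates inside a finite set `S'` of
  coordinates change an integer statistic `X` EXACTLY by the difference of calibrated signs (on
  the "active" configurations), then refilling all of `S'` changes `X` by the sum of the sign
  differences.
-/

namespace Summit.QuantumFields.QCD.Cruxes.WindowExtinction.FreeVolumeHeavyWitness

open scoped BigOperators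

variable {I T : Type*} [DecidableEq I]

/-- Splicing `s` into `s₀` on a finite set of coordinates `J`: inserting a new coordinate is a
single update. -/
theorem spread_splice_insert (s₀ s : I → T) (J : Finset I) (a : I) :
    (fun i => if i ∈ insert a J then s i else s₀ i) =
      Function.update (fun i => if i ∈ J then s i else s₀ i) a (s a) := by
  funext i
  by_cases h : i = a
  · subst h; simp
  · simp [Finset.mem_insert, h]

/-- First-order step of the telescoping: the increment of `φ` in coordinate `a` at the spliced
point differs from the increment at the base point by at most `|J| γ`. -/
theorem spread_telescope_step (φ : (I → T) → ℝ) {γ : ℝ}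
    (hγ : ∀ (s : I → T) (i j : I), i ≠ j → ∀ (u v : T),
      |φ (Function.update (Function.update s i u) j v) - φ (Function.update s i u)
        - φ (Function.update s j v) + φ s| ≤ γ)
    (s₀ s : I → T) (a : I) (w : T) (J : Finset I) (haJ : a ∉ J) :
    |φ (Function.update (fun i => if i ∈ J then s i else s₀ i) a w)
        - φ (fun i => if i ∈ J then s i else s₀ i)
        - φ (Function.update s₀ a w) + φ s₀| ≤ J.card * γ := by
  induction J using Finset.induction_on with
  | empty => simp
  | insert b J hbJ ih =>
    have hab : a ≠ b := by rintro rfl; exact haJ (Finset.mem_insert_self _ _)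
    have haJ' : a ∉ J := fun h => haJ (Finset.mem_insert_of_mem h)
    have ih' := ih haJ'
    rw [spread_splice_insert s₀ s J b, Finset.card_insert_of_notMem hbJ]
    set sJ : I → T := fun i => if i ∈ J then s i else s₀ i with hsJ
    have hmix := hγ sJ b a (Ne.symm hab) (s b) w
    have hsplit : φ (Function.update (Function.update sJ b (s b)) a w)
        - φ (Function.update sJ b (s b)) - φ (Function.update s₀ a w) + φ s₀ =
        (φ (Function.update (Function.update sJ b (s b)) a w) - φ (Function.update sJ b (s b))
          - φ (Function.update sJ a w) + φ sJ) +
        (φ (Function.update sJ a w) - φ sJ - φ (Function.update s₀ a w) + φ s₀) := by ring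
    rw [hsplit]
    refine (abs_add_le _ _).trans ?_
    push_cast
    linarith

/-- Spliced telescoping: `|φ(s_J) - φ(s₀) - ∑_{i ∈ J} (φ(s₀[i ↦ s i]) - φ(s₀))| ≤ |J|² γ`. -/
theorem spread_telescope_splice (φ : (I → T) → ℝ) {γ : ℝ} (hγ0 : 0 ≤ γ)
    (hγ : ∀ (s : I → T) (i j : I), i ≠ j → ∀ (u v : T),
      |φ (Function.update (Function.update s i u) j v) - φ (Function.update s i u)
        - φ (Function.update s j v) + φ s| ≤ γ)
    (s₀ s : I → T) (J : Finset I) :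
    |φ (fun i => if i ∈ J then s i else s₀ i) - φ s₀
        - ∑ i ∈ J, (φ (Function.update s₀ i (s i)) - φ s₀)| ≤ J.card * J.card * γ := by
  induction J using Finset.induction_on with
  | empty => simp
  | insert a J haJ ih =>
    rw [spread_splice_insert s₀ s J a, Finset.sum_insert haJ, Finset.card_insert_of_notMem haJ]
    set sJ : I → T := fun i => if i ∈ J then s i else s₀ i with hsJ
    have hstep := spread_telescope_step φ hγ s₀ s a (s a) J haJ
    have hsplit : φ (Function.update sJ a (s a)) - φ s₀ -
        (φ (Function.update s₀ a (s a)) - φ s₀ + ∑ i ∈ J, (φ (Function.update s₀ i (s i)) - φ s₀)) =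
        (φ (Function.update sJ a (s a)) - φ sJ - φ (Function.update s₀ a (s a)) + φ s₀) +
        (φ sJ - φ s₀ - ∑ i ∈ J, (φ (Function.update s₀ i (s i)) - φ s₀)) := by ring
    rw [hsplit]
    refine (abs_add_le _ _).trans ?_
    have hJ : (0 : ℝ) ≤ J.card := Nat.cast_nonneg _
    push_cast
    nlinarith

/-- **Approximate additivity from small mixed differences.** If every mixed second difference of
`φ : (I → T) → ℝ` in two distinct coordinates is at most `γ ≥ 0` in absolute value, then for all
`s₀, s`: `|φ s - φ s₀ - ∑ i, (φ (s₀[i ↦ s i]) - φ s₀)| ≤ (card I)² γ`. -/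
theorem spread_telescope_abs_le :
    ∀ {I T : Type*} [DecidableEq I] [Fintype I] (φ : (I → T) → ℝ) {γ : ℝ}, 0 ≤ γ →
      (∀ (s : I → T) (i j : I), i ≠ j → ∀ (u v : T),
        |φ (Function.update (Function.update s i u) j v) - φ (Function.update s i u)
          - φ (Function.update s j v) + φ s| ≤ γ) →
      ∀ (s₀ s : I → T),
        |φ s - φ s₀ - ∑ i, (φ (Function.update s₀ i (s i)) - φ s₀)| ≤
          (Fintype.card I : ℝ) ^ 2 * γ := by
  intro I T _ _ φ γ hγ0 hγ s₀ s
  have h := spread_telescope_splice φ hγ0 hγ s₀ s Finset.univ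
  have hs : (fun i => if i ∈ (Finset.univ : Finset I) then s i else s₀ i) = s := by
    funext i; simp
  rw [hs, Finset.card_univ] at h
  simpa [sq] using h

/-! ## Exact additivity of an integer statistic under refills -/

/-- Refilling the coordinates of `S'` spliced on a finite set `J ⊆ S'`: inserting one more
coordinate is a single update of the refilled configuration. -/
theorem spread_updateFinset_splice_insert (r : I → T) (S' : Finset I) (q₀ q : ↥S' → T)
    (J : Finset ↥S') (a : ↥S') :
    Function.updateFinset r S' (fun i => if i ∈ insert a J then q i else q₀ i) =
      Function.update (Function.updateFinset r S' (fun i => if i ∈ J then q i else q₀ i))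
        a (q a) := by
  funext i
  by_cases h : i = (a : I)
  · subst h
    simp [Function.updateFinset, a.2]
  · rw [Function.update_of_ne h]
    by_cases hi : i ∈ S'
    · have hne : (⟨i, hi⟩ : ↥S') ≠ a := fun h' => h (congrArg Subtype.val h')
      simp [Function.updateFinset, hi, Finset.mem_insert, hne]
    · simp [Function.updateFinset, hi]

/-- **Exact additivity under refills.** Let `sgn : T → ℤ` be a calibration, `A ⊆ T` the active
values and `S'` a finite set of coordinates such that for every configuration `t` with all
coordinates active, updating one coordinate `i ∈ S'` to an active value `u` changes `X` by exactly
`sgn u - sgn (t i)`.  Then for `r` with all coordinates active and every active refill `q` of the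
coordinates in `S'`, `X (updateFinset r S' q) = X r + ∑_{i ∈ S'} (sgn (q i) - sgn (r i))`. -/
theorem spread_exact_updateFinset (X : (I → T) → ℤ) (sgn : T → ℤ) (A : Set T) (S' : Finset I)
    (hX : ∀ t : I → T, (∀ i, t i ∈ A) → ∀ i ∈ S', ∀ u ∈ A,
      X (Function.update t i u) - X t = sgn u - sgn (t i))
    (r : I → T) (hr : ∀ i, r i ∈ A) (q : ↥S' → T) (hq : ∀ i, q i ∈ A) :
    X (Function.updateFinset r S' q) = X r + ∑ i : ↥S', (sgn (q i) - sgn (r i)) := by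
  classical
  -- splice `q` into the restriction of `r` on a growing finite set of coordinates of `S'`
  set q₀ : ↥S' → T := fun i => r i with hq₀
  have hbase : Function.updateFinset r S' q₀ = r := by
    funext i
    by_cases hi : i ∈ S' <;> simp [Function.updateFinset, hi, hq₀]
  have key : ∀ J : Finset ↥S',
      X (Function.updateFinset r S' (fun i => if i ∈ J then q i else q₀ i)) =
        X r + ∑ i ∈ J, (sgn (q i) - sgn (r i)) := by
    intro J
    induction J using Finset.induction_on with
    | empty => simp [hbase]
    | insert a J haJ ih =>
      rw [spread_updateFinset_splice_insert, Finset.sum_insert haJ]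
      set t : I → T := Function.updateFinset r S' (fun i => if i ∈ J then q i else q₀ i) with ht
      have htA : ∀ i, t i ∈ A := by
        intro i
        by_cases hi : i ∈ S'
        · simp only [ht, Function.updateFinset, hi, dif_pos]
          split_ifs
          · exact hq _
          · exact hr _
        · simp only [ht, Function.updateFinset, hi, dif_neg, not_false_eq_true]
          exact hr _
      have hta : t a = r a := by
        simp [ht, Function.updateFinset, a.2, haJ, hq₀]
      have h := hX t htA a a.2 (q a) (hq a)
      rw [hta] at h
      linarith [ih]
  have hfin := key Finset.univ
  simp only [Finset.mem_univ, if_true] at hfin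
  exact hfin

end Summit.QuantumFields.QCD.Cruxes.WindowExtinction.FreeVolumeHeavyWitness
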